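import Literature.MathematicalPhysics.QuantumLattice.HubbardTTPrimePhaseCoexistenceExclusionGrandCanonical
import Literature.MathematicalPhysics.QuantumLattice.HubbardTTPrimeGrandCanonicalEnsembleEquivalence
import HarnessLib

/-!
# The STATE-LEVEL ensemble dictionary at `T > 0` (and model-free at `T = 0` / `T > 0`): a translation-invariant state is a
# grand-canonical equilibrium state of `H − μN` IF AND ONLY IF it is a canonical equilibrium state at its own density AND `μ`
# SUPPORTS the canonical pressure there; the chemical potentials carrying a given state form a compact interval

Topic `Literature/MathematicalPhysics/QuantumLattice` (family `hubbard`; cell `pub/hubbard-downfold`, MO-S1 ↔ S2 seam «box ↦ one word», filling direction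
= the Legendre pair `μ ↔ n`; written 2026-08-28 by hubbard-downfold-unc-2 g23). The tree has: the FUNCTION-level equivalence of ensembles at `T > 0`
(`gcPressureTT'_eq_sSup_pressureTT'`, `pressureTT'_eq_iInf_gcPressureTT'`, `exists_chemicalPotential_pressureTT'_eq` — a SUPPORTING chemical potential
`μ₀` of `p(β;·)` at `n`, `p(n) = P(μ₀) − βμ₀n`); the Legendre step «grand-canonical equilibrium ⇒ canonical at its density, `−βμ` a supergradient»
(`TIDensityPhaseCoexistenceGrandCanonical` §2, g22); the special case «canonical sector-Gibbs torus limits are grand-canonical equilibria at every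
supporting `μ₀`» (`IsTorusLimitOfMixture.isVarEquilibrium_of_sectorGibbs`); the `T = 0` state-level dictionary for the `t–t'` model
(`HubbardTTPrimeGrandCanonicalGroundStateDictionary`, g22); and the DENSITY side of the coexistence correspondence (`HubbardTTPrimeGrandCanonicalDensityCoexistenceInterval`:
the equilibrium densities at `(β, μ)` fill `[ρ₋(μ), ρ₊(μ)]`). This file closes the square at `T > 0` and supplies the model-free editions:

* §1 MODEL-FREE, `T = 0` (any `Ψ` on `ℤ^d`, any `Γ` with `e_Γ = e_Ψ − μρ`): **`isMeanEnergyMinimiser_iff_of_muShift`** — `ω` is a grand-canonical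
  ground state iff `e_Ψ(ω) = e_{ρ(ω)}(Ψ)` and `μ` is a subgradient of `ρ ↦ e_ρ(Ψ)` at `ρ(ω)` over the realised densities; the carrier set is
  order-connected (`IsMeanEnergyMinimiser.of_mem_Icc_of_muShift`: carried at `μ₁ ≤ μ₂` ⇒ carried at every `μ ∈ [μ₁, μ₂]`).
* §2 MODEL-FREE, `T > 0` (`IsVarEquilibrium β Γ`): **`isVarEquilibrium_iff_of_muShift`** — `ω` is a grand-canonical equilibrium state iff
  `s̄(ω) − βe_Ψ(ω) = P(β,Ψ;ρ(ω))` (`varPressureAt`) and `−βμ` is a supergradient of `P(β,Ψ;·)` at `ρ(ω)`; carrier sets are order-connected for `β ≥ 0`.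
* §3 THE `t–t'` MODEL AT `T > 0` (`β > 0`, `U ≥ 0`): `varPressure_eq_gcPressureTT'_of_muShift` (`P_var(β, Γ) = P(β;t,t',U;μ)` for every `μ`-shift `Γ`);
  **`isVarEquilibrium_iff_sub_mul_eq_pressureTT'_and_supporting`** — for translation-invariant `ω` with `0 < ρ(ω) < 2`: `ω` is a grand-canonical
  equilibrium state at `(β, μ)` IFF `s̄(ω) − βe_Φ(ω) = p(β; ρ(ω))` AND `p(β; ρ(ω)) = P(β; μ) − βμρ(ω)` (`μ` SUPPORTS `p(β;·)` at `ρ(ω)`); the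
  converse half needs no density restriction (`isVarEquilibrium_of_sub_mul_eq_pressureTT'_of_supporting` — EVERY canonical equilibrium state, not
  only a sector-Gibbs torus limit, is a grand-canonical one at every supporting `μ`); corollary `IsVarEquilibrium.isVarEquilibrium_iff_supporting`
  («the set of `μ'` carrying a given grand-canonical equilibrium state is EXACTLY the supporting set of its density»); pencil instances for
  `gcInteractionTT' t t' U μ 0` and `hubbardTTPrimeMuInteraction t t' U μ`.
* §4 THE SUPPORTING SET `M_β(n) = {μ : p(β;n) = P(β;μ) − βμn}` of a density `0 < n < 2` is a NONEMPTY COMPACT INTERVAL: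
  `continuous_gcPressureTT'` (`2β`-Lipschitz), `isClosed_supportingSet`, `ordConnected_supportingSet`, `bddAbove/bddBelow_supportingSet` (secant
  slopes of `p` on either side), **`supportingSet_eq_Icc`**: `M_β(n) = [sInf M_β(n), sSup M_β(n)]` — the `T > 0` chemical-potential CELL of a density,
  the twin of `[μ₋(n), μ₊(n)]` at `T = 0`; hence `IsVarEquilibrium.setOf_carrier_eq_Icc`: the chemical potentials carrying a grand-canonical
  equilibrium state of interior density form exactly that compact interval.

USE (the seam): the two `T > 0` state classes of the programme — hubbard-thermal's CANONICAL objects of record (any translation-invariant state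
attaining `p(β;n)`) and the grand-canonical states of the Markov / KMS certificates at `(β, μ)` — are ONE class indexed by the graph of the supporting
correspondence `n ↔ μ`; every canonical `T > 0` row becomes a statement about grand-canonical equilibrium states at explicit `μ` (bracketed by the
certified `μ`-band of `n`, `HubbardTTPrimeThermalPressureChemicalPotentialBand`) and conversely. HONEST SCOPE: structural; translation-invariant
variational equilibria (Araki–Moriya's solutions of the variational principle) / mean-energy minimisers; no existence claim beyond the tree's, no
uniqueness, no number, no named fact, no definition (the cell ends are `sInf/sSup` of a set, not new constants). Everything is PROVED, 0 sorry.

## Mathlib / tree search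
REUSED: `IsMeanEnergyMinimiser.meanEnergy_eq_tiGroundEnergyDensityAt_of_muShift`, `…tiGroundEnergyDensityAt_add_mul_sub_le_of_muShift`,
`IsVarEquilibrium.sub_mul_eq_varPressureAt_of_muShift`, `…varPressureAt_add_mul_le_of_muShift` (`TIDensityPhaseCoexistenceGrandCanonical`);
`tiGroundEnergyDensityAt_le_meanEnergy`, `sub_mul_le_varPressureAt`, `varPressureAt_hubbardTTPrime_eq` (`CanonicalVariationalPressure`); `varPressure_le`,
`sub_mul_le_varPressure`, `varPressure_gcInteractionTT'_eq`, `IsVarEquilibrium` (`TIVariationalPressure`); `gcPressureTT'Zeeman_zero`;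
`meanEnergy_gcInteractionTT'_zero_field_eq_sub`, `meanEnergy_hubbardTTPrimeMu_eq_sub` (`HubbardTTPrimePhaseCoexistenceExclusionGrandCanonical`);
`pressureTT'_le_gcPressureTT'_sub`, `gcPressureTT'_mono`, `gcPressureTT'_sub_le`, `exists_chemicalPotential_pressureTT'_eq`
(`HubbardTTPrimeGrandCanonicalEnsembleEquivalence`); Mathlib `LipschitzWith.of_le_add_mul`, `isClosed_eq`, `Set.OrdConnected`, `eq_Icc_of_connected_compact`,
`Metric.isCompact_of_isClosed_isBounded`, `isBounded_of_bddAbove_of_bddBelow`. `lean search 'IsVarEquilibrium.*iff.*pressureTT|supporting.*Icc|carrier'`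
(2026-08-28): only the function-level results and the sector-Gibbs special case listed above.

## References
* R. B. Israel, *Convexity in the Theory of Lattice Gases* (1979), Thm. I.2.4 (tangent functionals ↔ equilibrium states), §V.1. [cite: Israel1979, Thm. I.2.4]
* D. Ruelle, *Statistical Mechanics: Rigorous Results* (1969), §3.4 (equivalence of ensembles; `μ` conjugate to the density). [cite: Ruelle1969, §3.4]
* H. Araki, H. Moriya, Rev. Math. Phys. 15 (2003) 93, Thm. 12.11 (solutions of the variational principle). [cite: ArakiMoriya2003, Theorem 12.11]
* O. Bratteli, A. Kishimoto, D. W. Robinson, Commun. Math. Phys. 64 (1978) 41, Thm. 2. [cite: BratteliKishimotoRobinson1978, Thm. 2 (condition 2)]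
* R. T. Rockafellar, *Convex Analysis* (1970), Thm. 23.5 / 24.1 (subdifferentials of conjugate pairs; one-sided derivatives). [cite: Rockafellar1970, Thm. 24.1]
-/

noncomputable section

open scoped ComplexOrder BigOperators

namespace Literature.MathematicalPhysics.QuantumLattice

open Matrix HubbardWave0 Literature.Probability.LatticeModels ThermodynamicLimit InfVolFermionState FermionInteraction Set

namespace InfVolFermionState

/-! ## §1 Model-free, `T = 0`: grand-canonical ground states of a `μ`-shift `Γ` of `Ψ` on `ℤ^d` -/

section GroundStates

variable {d : ℕ} (Ψ : FermionInteraction d) (R : ℝ) {Γ Γ₁ Γ₂ : FermionInteraction d} {R' R₁ R₂ μ μ₁ μ₂ : ℝ} {ω : InfVolFermionState d}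

/-- **Canonical ground state + subgradient ⇒ grand-canonical ground state (model-free, `T = 0`).** If `ω` is translation invariant,
`e_Ψ(ω) = e_{ρ(ω)}(Ψ)`, and `e_{ρ(ω)}(Ψ) + μ(n − ρ(ω)) ≤ e_n(Ψ)` at every realised density `n`, then `ω` minimises `e_Γ = e_Ψ − μρ` over all
translation-invariant states. [cite: Israel1979, Thm. I.2.4] [cite: Ruelle1969, §3.4] -/
theorem isMeanEnergyMinimiser_of_meanEnergy_eq_of_forall_tangent (hω : ω.IsTranslationInvariant)
    (hΓ : ∀ σ : InfVolFermionState d, σ.meanEnergy Γ R' = σ.meanEnergy Ψ R - μ * σ.density)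
    (he : ω.meanEnergy Ψ R = Ψ.tiGroundEnergyDensityAt R ω.density)
    (hμ : ∀ n : ℝ, (∃ σ : InfVolFermionState d, σ.IsTranslationInvariant ∧ σ.density = n) →
      Ψ.tiGroundEnergyDensityAt R ω.density + μ * (n - ω.density) ≤ Ψ.tiGroundEnergyDensityAt R n) :
    ω.IsMeanEnergyMinimiser Γ R' := by
  refine ⟨hω, fun σ hσ => ?_⟩
  rw [hΓ, hΓ, he]
  have h1 := Ψ.tiGroundEnergyDensityAt_le_meanEnergy R hσ (rfl : σ.density = σ.density)
  have h2 := hμ σ.density ⟨σ, hσ, rfl⟩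
  linarith

/-- **THE MODEL-FREE `T = 0` DICTIONARY.** For translation-invariant `ω` and any `Γ` with `e_Γ = e_Ψ − μρ`: `ω` is a grand-canonical ground state
(translation-invariant mean-energy minimiser of `Γ`) IFF `e_Ψ(ω) = e_{ρ(ω)}(Ψ)` (canonical ground state at its density) AND `μ` is a subgradient of
`ρ ↦ e_ρ(Ψ)` at `ρ(ω)` over the realised densities. [cite: Israel1979, Thm. I.2.4] [cite: BratteliKishimotoRobinson1978, Thm. 2 (condition 2)] -/
theorem isMeanEnergyMinimiser_iff_of_muShift (hω : ω.IsTranslationInvariant)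
    (hΓ : ∀ σ : InfVolFermionState d, σ.meanEnergy Γ R' = σ.meanEnergy Ψ R - μ * σ.density) :
    ω.IsMeanEnergyMinimiser Γ R' ↔
      ω.meanEnergy Ψ R = Ψ.tiGroundEnergyDensityAt R ω.density ∧
        ∀ n : ℝ, (∃ σ : InfVolFermionState d, σ.IsTranslationInvariant ∧ σ.density = n) →
          Ψ.tiGroundEnergyDensityAt R ω.density + μ * (n - ω.density) ≤ Ψ.tiGroundEnergyDensityAt R n :=
  ⟨fun h => ⟨h.meanEnergy_eq_tiGroundEnergyDensityAt_of_muShift Ψ R hΓ,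
      fun _ hn => h.tiGroundEnergyDensityAt_add_mul_sub_le_of_muShift Ψ R hΓ hn⟩,
    fun h => isMeanEnergyMinimiser_of_meanEnergy_eq_of_forall_tangent Ψ R hω hΓ h.1 h.2⟩

/-- **The chemical potentials carrying a grand-canonical ground state form an order-connected set (`T = 0`, model-free).** If `ω` is a
grand-canonical ground state at `μ₁` and at `μ₂` (shifts `Γ₁`, `Γ₂` of `Ψ`), then at every `μ ∈ [μ₁, μ₂]` (shift `Γ`).
[cite: Rockafellar1970, Thm. 24.1] [cite: Ruelle1969, §3.4] -/
theorem IsMeanEnergyMinimiser.of_mem_Icc_of_muShift (h₁ : ω.IsMeanEnergyMinimiser Γ₁ R₁)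
    (hΓ₁ : ∀ σ : InfVolFermionState d, σ.meanEnergy Γ₁ R₁ = σ.meanEnergy Ψ R - μ₁ * σ.density)
    (h₂ : ω.IsMeanEnergyMinimiser Γ₂ R₂)
    (hΓ₂ : ∀ σ : InfVolFermionState d, σ.meanEnergy Γ₂ R₂ = σ.meanEnergy Ψ R - μ₂ * σ.density)
    (hΓ : ∀ σ : InfVolFermionState d, σ.meanEnergy Γ R' = σ.meanEnergy Ψ R - μ * σ.density) (hμ : μ ∈ Icc μ₁ μ₂) :
    ω.IsMeanEnergyMinimiser Γ R' := by
  refine ⟨h₁.1, fun σ hσ => ?_⟩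
  have k1 := h₁.2 σ hσ
  have k2 := h₂.2 σ hσ
  rw [hΓ₁, hΓ₁] at k1
  rw [hΓ₂, hΓ₂] at k2
  rw [hΓ, hΓ]
  rcases le_total σ.density ω.density with hle | hle
  · nlinarith [mul_le_mul_of_nonneg_right hμ.1 (sub_nonneg.2 hle)]
  · nlinarith [mul_le_mul_of_nonneg_right hμ.2 (sub_nonneg.2 hle)]

end GroundStates

/-! ## §2 Model-free, `T > 0`: grand-canonical equilibrium states (`IsVarEquilibrium β Γ`) of a `μ`-shift `Γ` of `Ψ` -/

section Equilibria

variable {d : ℕ} (β : ℝ) (Ψ : FermionInteraction d) (R : ℝ) {Γ Γ₁ Γ₂ : FermionInteraction d} {R' R₁ R₂ μ μ₁ μ₂ : ℝ}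
  {ω : InfVolFermionState d}

/-- **Canonical equilibrium + supergradient ⇒ grand-canonical equilibrium (model-free, `T > 0`).** If `ω` is translation invariant,
`s̄(ω) − βe_Ψ(ω) = P(β,Ψ;ρ(ω))`, and `P(β,Ψ;n) + βμ(n − ρ(ω)) ≤ P(β,Ψ;ρ(ω))` at every realised density `n`, then `ω` maximises
`s̄ − βe_Γ` (`e_Γ = e_Ψ − μρ`) over all translation-invariant states. [cite: Israel1979, Thm. I.2.4] [cite: ArakiMoriya2003, Theorem 12.11] -/
theorem isVarEquilibrium_of_sub_mul_eq_varPressureAt_of_forall_tangent (hω : ω.IsTranslationInvariant)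
    (hΓ : ∀ σ : InfVolFermionState d, σ.meanEnergy Γ R' = σ.meanEnergy Ψ R - μ * σ.density)
    (hs : ω.entropyDensitySup - β * ω.meanEnergy Ψ R = Ψ.varPressureAt β R ω.density)
    (hμ : ∀ n : ℝ, (∃ σ : InfVolFermionState d, σ.IsTranslationInvariant ∧ σ.density = n) →
      Ψ.varPressureAt β R n + β * μ * (n - ω.density) ≤ Ψ.varPressureAt β R ω.density) :
    ω.IsVarEquilibrium β Γ R' := by
  refine ⟨hω, le_antisymm (Γ.sub_mul_le_varPressure β R' hω) ?_⟩
  refine Γ.varPressure_le β R' fun σ hσ => ?_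
  rw [hΓ, hΓ]
  have h1 := Ψ.sub_mul_le_varPressureAt β R σ.density hσ rfl
  have h2 := hμ σ.density ⟨σ, hσ, rfl⟩
  have e1 : β * (σ.meanEnergy Ψ R - μ * σ.density) = β * σ.meanEnergy Ψ R - β * μ * σ.density := by ring
  have e2 : β * (ω.meanEnergy Ψ R - μ * ω.density) = β * ω.meanEnergy Ψ R - β * μ * ω.density := by ring
  rw [e1, e2]
  linarith

/-- **THE MODEL-FREE `T > 0` DICTIONARY.** For translation-invariant `ω` and any `Γ` with `e_Γ = e_Ψ − μρ`: `ω` is a grand-canonical equilibrium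
state (`IsVarEquilibrium β Γ`) IFF `s̄(ω) − βe_Ψ(ω) = P(β,Ψ;ρ(ω))` (canonical variational equilibrium at its density) AND
`P(β,Ψ;n) + βμ(n − ρ(ω)) ≤ P(β,Ψ;ρ(ω))` at every realised density `n` (`−βμ` a supergradient of the concave `P(β,Ψ;·)`).
[cite: Israel1979, Thm. I.2.4] [cite: ArakiMoriya2003, Theorem 12.11] -/
theorem isVarEquilibrium_iff_of_muShift (hω : ω.IsTranslationInvariant)
    (hΓ : ∀ σ : InfVolFermionState d, σ.meanEnergy Γ R' = σ.meanEnergy Ψ R - μ * σ.density) :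
    ω.IsVarEquilibrium β Γ R' ↔
      ω.entropyDensitySup - β * ω.meanEnergy Ψ R = Ψ.varPressureAt β R ω.density ∧
        ∀ n : ℝ, (∃ σ : InfVolFermionState d, σ.IsTranslationInvariant ∧ σ.density = n) →
          Ψ.varPressureAt β R n + β * μ * (n - ω.density) ≤ Ψ.varPressureAt β R ω.density :=
  ⟨fun h => ⟨h.sub_mul_eq_varPressureAt_of_muShift β Ψ R hΓ, fun _ hn => h.varPressureAt_add_mul_le_of_muShift β Ψ R hΓ hn⟩,
    fun h => isVarEquilibrium_of_sub_mul_eq_varPressureAt_of_forall_tangent β Ψ R hω hΓ h.1 h.2⟩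

/-- **Carrier sets are order-connected (`T > 0`, model-free, `β ≥ 0`).** If `ω` is a grand-canonical equilibrium state at `μ₁` and at `μ₂`
(shifts `Γ₁`, `Γ₂` of `Ψ`, the same `β`), then at every `μ ∈ [μ₁, μ₂]`. [cite: Rockafellar1970, Thm. 24.1] [cite: Israel1979, Thm. I.2.4] -/
theorem IsVarEquilibrium.of_mem_Icc_of_muShift (hβ : 0 ≤ β) (h₁ : ω.IsVarEquilibrium β Γ₁ R₁)
    (hΓ₁ : ∀ σ : InfVolFermionState d, σ.meanEnergy Γ₁ R₁ = σ.meanEnergy Ψ R - μ₁ * σ.density)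
    (h₂ : ω.IsVarEquilibrium β Γ₂ R₂)
    (hΓ₂ : ∀ σ : InfVolFermionState d, σ.meanEnergy Γ₂ R₂ = σ.meanEnergy Ψ R - μ₂ * σ.density)
    (hΓ : ∀ σ : InfVolFermionState d, σ.meanEnergy Γ R' = σ.meanEnergy Ψ R - μ * σ.density) (hμ : μ ∈ Icc μ₁ μ₂) :
    ω.IsVarEquilibrium β Γ R' := by
  refine ⟨h₁.1, le_antisymm (Γ.sub_mul_le_varPressure β R' h₁.1) ?_⟩
  refine Γ.varPressure_le β R' fun σ hσ => ?_
  have k1 := Γ₁.sub_mul_le_varPressure β R₁ hσ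
  have k2 := Γ₂.sub_mul_le_varPressure β R₂ hσ
  rw [← h₁.2, hΓ₁, hΓ₁] at k1
  rw [← h₂.2, hΓ₂, hΓ₂] at k2
  rw [hΓ, hΓ]
  have e1 : ∀ ν : ℝ, β * (σ.meanEnergy Ψ R - ν * σ.density) = β * σ.meanEnergy Ψ R - β * ν * σ.density := fun ν => by ring
  have e2 : ∀ ν : ℝ, β * (ω.meanEnergy Ψ R - ν * ω.density) = β * ω.meanEnergy Ψ R - β * ν * ω.density := fun ν => by ring
  rw [e1, e2] at k1 k2 ⊢
  rcases le_total σ.density ω.density with hle | hle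
  · have hm : β * μ₁ * (ω.density - σ.density) ≤ β * μ * (ω.density - σ.density) :=
      mul_le_mul_of_nonneg_right (mul_le_mul_of_nonneg_left hμ.1 hβ) (sub_nonneg.2 hle)
    nlinarith [hm]
  · have hm : β * μ * (σ.density - ω.density) ≤ β * μ₂ * (σ.density - ω.density) :=
      mul_le_mul_of_nonneg_right (mul_le_mul_of_nonneg_left hμ.2 hβ) (sub_nonneg.2 hle)
    nlinarith [hm]

end Equilibria

/-! ## §3 The `t–t'` Hubbard model at `T > 0`: `μ` SUPPORTS `p(β;·)` at the density -/

section TTPrime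

variable (t t' : ℝ) {U : ℝ} (hU : 0 ≤ U) {β : ℝ} (hβ : 0 < β) {Γ Γ' : FermionInteraction 2} {R' R'' μ μ' : ℝ} {ω : InfVolFermionState 2}
include hU hβ

/-- **The variational pressure of every `μ`-shift of `Φ(t,t',U)` is the grand-canonical pressure**: `P_var(β, Γ) = P(β; t,t',U; μ)` whenever
`e_Γ = e_Φ − μρ` (the functional `s̄ − βe_Γ` coincides with that of `gcInteractionTT' t t' U μ 0`). [cite: ArakiMoriya2003, Theorem 12.11] [cite: Ruelle1969, §3.4] -/
theorem varPressure_eq_gcPressureTT'_of_muShift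
    (hΓ : ∀ σ : InfVolFermionState 2, σ.meanEnergy Γ R' = σ.meanEnergy (hubbardTTPrimeFermionInteraction t t' U) 1 - μ * σ.density) :
    Γ.varPressure β R' = gcPressureTT' β t t' U μ := by
  rw [← gcPressureTT'Zeeman_zero, ← varPressure_gcInteractionTT'_eq hβ.le t t' hU μ 0]
  refine le_antisymm ?_ ?_
  · refine Γ.varPressure_le β R' fun σ hσ => ?_
    have h := (gcInteractionTT' t t' U μ 0).sub_mul_le_varPressure β 1 hσ
    rwa [meanEnergy_gcInteractionTT'_zero_field_eq_sub, ← hΓ] at h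
  · refine (gcInteractionTT' t t' U μ 0).varPressure_le β 1 fun σ hσ => ?_
    have h := Γ.sub_mul_le_varPressure β R' hσ
    rwa [hΓ, ← meanEnergy_gcInteractionTT'_zero_field_eq_sub] at h

/-- **Grand-canonical ⇒ canonical at its density (`T > 0`, `t–t'`)**: a grand-canonical equilibrium state of interior density attains the
canonical pressure of record, `s̄(ω) − βe_Φ(ω) = p(β; t,t',U; ρ(ω))`. [cite: Israel1979, Thm. I.2.4] [cite: ArakiMoriya2003, Theorem 12.11] -/
theorem IsVarEquilibrium.entropyDensitySup_sub_mul_eq_pressureTT'_of_muShift (hω : ω.IsVarEquilibrium β Γ R')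
    (hΓ : ∀ σ : InfVolFermionState 2, σ.meanEnergy Γ R' = σ.meanEnergy (hubbardTTPrimeFermionInteraction t t' U) 1 - μ * σ.density)
    (hρ0 : 0 < ω.density) (hρ2 : ω.density < 2) :
    ω.entropyDensitySup - β * ω.meanEnergy (hubbardTTPrimeFermionInteraction t t' U) 1 = pressureTT' β t t' U ω.density := by
  rw [← varPressureAt_hubbardTTPrime_eq hβ t t' hU hρ0 hρ2]
  exact hω.sub_mul_eq_varPressureAt_of_muShift β _ 1 hΓ

/-- **Grand-canonical at `μ` ⇒ `μ` SUPPORTS `p(β;·)` at the density**: `p(β; ρ(ω)) = P(β; μ) − βμρ(ω)` — the Legendre supremum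
`P(μ) = sup_n [p(n) + βμn]` is attained at `n = ρ(ω)`. [cite: Israel1979, Thm. I.2.4] [cite: Ruelle1969, §3.4] -/
theorem IsVarEquilibrium.pressureTT'_eq_gcPressureTT'_sub_of_muShift (hω : ω.IsVarEquilibrium β Γ R')
    (hΓ : ∀ σ : InfVolFermionState 2, σ.meanEnergy Γ R' = σ.meanEnergy (hubbardTTPrimeFermionInteraction t t' U) 1 - μ * σ.density)
    (hρ0 : 0 < ω.density) (hρ2 : ω.density < 2) :
    pressureTT' β t t' U ω.density = gcPressureTT' β t t' U μ - β * μ * ω.density := by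
  have h1 := hω.entropyDensitySup_sub_mul_eq_pressureTT'_of_muShift t t' hU hβ hΓ hρ0 hρ2
  have h2 := hω.2
  rw [varPressure_eq_gcPressureTT'_of_muShift t t' hU hβ hΓ, hΓ] at h2
  have e : β * (ω.meanEnergy (hubbardTTPrimeFermionInteraction t t' U) 1 - μ * ω.density) =
      β * ω.meanEnergy (hubbardTTPrimeFermionInteraction t t' U) 1 - β * μ * ω.density := by ring
  rw [e] at h2
  linarith

/-- **Canonical equilibrium + supporting `μ` ⇒ grand-canonical equilibrium (`t–t'`, ANY density).** A translation-invariant `ω` with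
`s̄(ω) − βe_Φ(ω) = p(β; ρ(ω))` and `p(β; ρ(ω)) = P(β; μ) − βμρ(ω)` is a grand-canonical equilibrium state of every `Γ` with `e_Γ = e_Φ − μρ` —
EVERY canonical equilibrium state (not only a sector-Gibbs torus limit) is grand-canonical at every supporting `μ`.
[cite: Israel1979, Thm. I.2.4] [cite: ArakiMoriya2003, Theorem 12.11] -/
theorem isVarEquilibrium_of_sub_mul_eq_pressureTT'_of_supporting (hω : ω.IsTranslationInvariant)
    (hΓ : ∀ σ : InfVolFermionState 2, σ.meanEnergy Γ R' = σ.meanEnergy (hubbardTTPrimeFermionInteraction t t' U) 1 - μ * σ.density)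
    (hs : ω.entropyDensitySup - β * ω.meanEnergy (hubbardTTPrimeFermionInteraction t t' U) 1 = pressureTT' β t t' U ω.density)
    (hμ : pressureTT' β t t' U ω.density = gcPressureTT' β t t' U μ - β * μ * ω.density) :
    ω.IsVarEquilibrium β Γ R' := by
  refine ⟨hω, ?_⟩
  rw [varPressure_eq_gcPressureTT'_of_muShift t t' hU hβ hΓ, hΓ]
  have e : β * (ω.meanEnergy (hubbardTTPrimeFermionInteraction t t' U) 1 - μ * ω.density) =
      β * ω.meanEnergy (hubbardTTPrimeFermionInteraction t t' U) 1 - β * μ * ω.density := by ring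
  rw [e]
  linarith

/-- **THE STATE-LEVEL ENSEMBLE DICTIONARY AT `T > 0` (2D `t–t'` Hubbard model, `β > 0`, `U ≥ 0`).** For translation-invariant `ω` with
`0 < ρ(ω) < 2` and any `Γ` with `e_Γ = e_Φ − μρ`: `ω` is a grand-canonical equilibrium state at `(β, μ)` IFF
`s̄(ω) − βe_Φ(ω) = p(β; t,t',U; ρ(ω))` (canonical equilibrium at its density) AND `p(β; ρ(ω)) = P(β; t,t',U; μ) − βμρ(ω)` (`μ` supports `p(β;·)`
at `ρ(ω)`). [cite: Israel1979, Thm. I.2.4] [cite: Ruelle1969, §3.4] [cite: ArakiMoriya2003, Theorem 12.11] -/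
theorem isVarEquilibrium_iff_sub_mul_eq_pressureTT'_and_supporting (hω : ω.IsTranslationInvariant)
    (hΓ : ∀ σ : InfVolFermionState 2, σ.meanEnergy Γ R' = σ.meanEnergy (hubbardTTPrimeFermionInteraction t t' U) 1 - μ * σ.density)
    (hρ0 : 0 < ω.density) (hρ2 : ω.density < 2) :
    ω.IsVarEquilibrium β Γ R' ↔
      ω.entropyDensitySup - β * ω.meanEnergy (hubbardTTPrimeFermionInteraction t t' U) 1 = pressureTT' β t t' U ω.density ∧
        pressureTT' β t t' U ω.density = gcPressureTT' β t t' U μ - β * μ * ω.density :=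
  ⟨fun h => ⟨h.entropyDensitySup_sub_mul_eq_pressureTT'_of_muShift t t' hU hβ hΓ hρ0 hρ2,
      h.pressureTT'_eq_gcPressureTT'_sub_of_muShift t t' hU hβ hΓ hρ0 hρ2⟩,
    fun h => isVarEquilibrium_of_sub_mul_eq_pressureTT'_of_supporting t t' hU hβ hω hΓ h.1 h.2⟩

/-- **The chemical potentials carrying a given grand-canonical equilibrium state are EXACTLY the supporting ones of its density.** If `ω` is
a grand-canonical equilibrium state at `(β, μ)` with `0 < ρ(ω) < 2`, then for every `μ'` (shift `Γ'`): `ω` is a grand-canonical equilibrium state at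
`(β, μ')` iff `p(β; ρ(ω)) = P(β; μ') − βμ'ρ(ω)`. [cite: Israel1979, Thm. I.2.4] [cite: Rockafellar1970, Thm. 24.1] -/
theorem IsVarEquilibrium.isVarEquilibrium_iff_supporting (hω : ω.IsVarEquilibrium β Γ R')
    (hΓ : ∀ σ : InfVolFermionState 2, σ.meanEnergy Γ R' = σ.meanEnergy (hubbardTTPrimeFermionInteraction t t' U) 1 - μ * σ.density)
    (hΓ' : ∀ σ : InfVolFermionState 2, σ.meanEnergy Γ' R'' = σ.meanEnergy (hubbardTTPrimeFermionInteraction t t' U) 1 - μ' * σ.density)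
    (hρ0 : 0 < ω.density) (hρ2 : ω.density < 2) :
    ω.IsVarEquilibrium β Γ' R'' ↔ pressureTT' β t t' U ω.density = gcPressureTT' β t t' U μ' - β * μ' * ω.density := by
  have hs := hω.entropyDensitySup_sub_mul_eq_pressureTT'_of_muShift t t' hU hβ hΓ hρ0 hρ2
  rw [isVarEquilibrium_iff_sub_mul_eq_pressureTT'_and_supporting t t' hU hβ hω.1 hΓ' hρ0 hρ2]
  exact ⟨fun h => h.2, fun h => ⟨hs, h⟩⟩

/-- **The grand-canonical interaction instance** (`gcInteractionTT' t t' U μ 0 = Φ − μn`): `ω` (translation invariant, `0 < ρ(ω) < 2`) is a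
grand-canonical equilibrium state at `(β; μ, h = 0)` iff `s̄(ω) − βe_Φ(ω) = p(β; ρ(ω))` and `μ` supports `p(β;·)` at `ρ(ω)`.
[cite: ArakiMoriya2003, Theorem 12.11] [cite: Ruelle1969, §3.4] -/
theorem isVarEquilibrium_gcInteractionTT'_iff (hω : ω.IsTranslationInvariant) (hρ0 : 0 < ω.density) (hρ2 : ω.density < 2) :
    ω.IsVarEquilibrium β (gcInteractionTT' t t' U μ 0) 1 ↔
      ω.entropyDensitySup - β * ω.meanEnergy (hubbardTTPrimeFermionInteraction t t' U) 1 = pressureTT' β t t' U ω.density ∧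
        pressureTT' β t t' U ω.density = gcPressureTT' β t t' U μ - β * μ * ω.density :=
  isVarEquilibrium_iff_sub_mul_eq_pressureTT'_and_supporting t t' hU hβ hω (meanEnergy_gcInteractionTT'_zero_field_eq_sub t t' U μ) hρ0 hρ2

/-- **The `μ`-pencil instance** (`hubbardTTPrimeMuInteraction t t' U μ`). [cite: ArakiMoriya2003, Theorem 12.11] [cite: Ruelle1969, §3.4] -/
theorem isVarEquilibrium_hubbardTTPrimeMu_iff (hω : ω.IsTranslationInvariant) (hρ0 : 0 < ω.density) (hρ2 : ω.density < 2) :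
    ω.IsVarEquilibrium β (hubbardTTPrimeMuInteraction t t' U μ) 1 ↔
      ω.entropyDensitySup - β * ω.meanEnergy (hubbardTTPrimeFermionInteraction t t' U) 1 = pressureTT' β t t' U ω.density ∧
        pressureTT' β t t' U ω.density = gcPressureTT' β t t' U μ - β * μ * ω.density :=
  isVarEquilibrium_iff_sub_mul_eq_pressureTT'_and_supporting t t' hU hβ hω (meanEnergy_hubbardTTPrimeMu_eq_sub t t' U μ) hρ0 hρ2

/-- **Canonical equilibrium states are grand-canonical ones at every supporting `μ₀`** (the instance used by the thermal cell: ANY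
translation-invariant `ω` with `s̄(ω) − βe_Φ(ω) = p(β; ρ(ω))` — e.g. a torus limit of sector Gibbs states, `…entropyDensitySup_sub_mul_eq_pressureTT'_of_sectorGibbs`
— is an equilibrium state of `gcInteractionTT' t t' U μ₀ 0` whenever `p(β; ρ(ω)) = P(β; μ₀) − βμ₀ρ(ω)`). [cite: ArakiMoriya2003, Theorem 12.11] [cite: Israel1979, Thm. I.2.4] -/
theorem isVarEquilibrium_gcInteractionTT'_of_sub_mul_eq_pressureTT'_of_supporting (hω : ω.IsTranslationInvariant)
    (hs : ω.entropyDensitySup - β * ω.meanEnergy (hubbardTTPrimeFermionInteraction t t' U) 1 = pressureTT' β t t' U ω.density)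
    {μ₀ : ℝ} (hμ₀ : pressureTT' β t t' U ω.density = gcPressureTT' β t t' U μ₀ - β * μ₀ * ω.density) :
    ω.IsVarEquilibrium β (gcInteractionTT' t t' U μ₀ 0) 1 :=
  isVarEquilibrium_of_sub_mul_eq_pressureTT'_of_supporting t t' hU hβ hω (meanEnergy_gcInteractionTT'_zero_field_eq_sub t t' U μ₀) hs hμ₀

end TTPrime

end InfVolFermionState

/-! ## §4 The supporting set `M_β(n) = {μ : p(β;n) = P(β;μ) − βμn}` of a density is a nonempty compact interval -/

namespace ThermodynamicLimit

section SupportingSet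

variable {β : ℝ} (hβ : 0 ≤ β) (t t' : ℝ) {U : ℝ} (hU : 0 ≤ U)
include hβ hU

/-- **`μ ↦ P(β; t,t',U; μ)` is `2β`-Lipschitz** (nondecreasing with increments `≤ 2β·Δμ`). [cite: Ruelle1969, §3.4] -/
theorem lipschitzWith_gcPressureTT' : LipschitzWith (2 * β).toNNReal (gcPressureTT' β t t' U) := by
  refine LipschitzWith.of_le_add_mul _ fun x y => ?_
  rw [Real.coe_toNNReal _ (by positivity), Real.dist_eq]
  rcases le_total x y with hxy | hyx
  · have h := gcPressureTT'_mono hβ t t' hU hxy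
    have : 0 ≤ 2 * β * |x - y| := by positivity
    linarith
  · have h := gcPressureTT'_sub_le hβ t t' hU hyx
    rw [abs_of_nonneg (sub_nonneg.2 hyx)]
    linarith

/-- **`μ ↦ P(β; t,t',U; μ)` is continuous.** [cite: Ruelle1969, §3.4] -/
theorem continuous_gcPressureTT' : Continuous (gcPressureTT' β t t' U) :=
  (lipschitzWith_gcPressureTT' hβ t t' hU).continuous

/-- **The supporting set of a density is closed.** [cite: Rockafellar1970, Thm. 24.1] -/
theorem isClosed_supportingSet (n : ℝ) :
    IsClosed {μ : ℝ | pressureTT' β t t' U n = gcPressureTT' β t t' U μ - β * μ * n} := by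
  have hc : Continuous fun μ : ℝ => gcPressureTT' β t t' U μ - β * μ * n :=
    (continuous_gcPressureTT' hβ t t' hU).sub ((continuous_const.mul continuous_id).mul continuous_const)
  exact isClosed_eq continuous_const hc

/-- **The supporting set of a density `0 ≤ n < 2` is order-connected** (convexity of `P` in `μ`, written as a two-sided comparison of
supergradients: for `m ≥ n` use `μ₂`, for `m ≤ n` use `μ₁`). [cite: Rockafellar1970, Thm. 24.1] [cite: Ruelle1969, §3.4] -/
theorem ordConnected_supportingSet {n : ℝ} (hn0 : 0 ≤ n) (hn2 : n < 2) :
    Set.OrdConnected {μ : ℝ | pressureTT' β t t' U n = gcPressureTT' β t t' U μ - β * μ * n} := by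
  refine ⟨fun μ₁ hμ₁ μ₂ hμ₂ μ hμ => ?_⟩
  simp only [Set.mem_setOf_eq] at hμ₁ hμ₂ ⊢
  refine le_antisymm (pressureTT'_le_gcPressureTT'_sub hβ t t' hU μ hn0 hn2) ?_
  -- `P(μ) ≤ p(n) + βμn`: every density term lies under the line
  suffices h : gcPressureTT' β t t' U μ ≤ pressureTT' β t t' U n + β * μ * n by linarith
  rw [gcPressureTT'_le_iff_pressureTT' hβ t t' hU]
  intro m hm0 hm2
  have k1 := pressureTT'_le_gcPressureTT'_sub hβ t t' hU μ₁ hm0 hm2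
  have k2 := pressureTT'_le_gcPressureTT'_sub hβ t t' hU μ₂ hm0 hm2
  rcases le_total m n with hle | hle
  · -- use `μ₁ ≤ μ`: `βμ₁(n − m) ≤ βμ(n − m)`
    have hm : β * μ₁ * (n - m) ≤ β * μ * (n - m) :=
      mul_le_mul_of_nonneg_right (mul_le_mul_of_nonneg_left hμ.1 hβ) (sub_nonneg.2 hle)
    nlinarith [hm, hμ₁, k1]
  · have hm : β * μ * (m - n) ≤ β * μ₂ * (m - n) :=
      mul_le_mul_of_nonneg_right (mul_le_mul_of_nonneg_left hμ.2 hβ) (sub_nonneg.2 hle)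
    nlinarith [hm, hμ₂, k2]

/-- **Upper secant bound**: if `μ` supports `p(β;·)` at `n` and `n < m < 2`, then `βμ(m − n) ≤ p(n) − p(m)`. [cite: Rockafellar1970, Thm. 24.1] -/
theorem mul_sub_le_of_mem_supportingSet {n μ : ℝ}
    (hμ : pressureTT' β t t' U n = gcPressureTT' β t t' U μ - β * μ * n) {m : ℝ} (hm0 : 0 ≤ m) (hm2 : m < 2) :
    β * μ * (m - n) ≤ pressureTT' β t t' U n - pressureTT' β t t' U m := by
  have k := pressureTT'_le_gcPressureTT'_sub hβ t t' hU μ hm0 hm2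
  nlinarith [k, hμ]

omit hβ hU in
/-- **The supporting set of a density `0 < n < 2` is bounded above** (by the secant slope to any `m ∈ (n, 2)`, `β > 0`). [cite: Rockafellar1970, Thm. 24.1] -/
theorem bddAbove_supportingSet (hβ' : 0 < β) (hU : 0 ≤ U) {n : ℝ} (hn0 : 0 < n) (hn2 : n < 2) :
    BddAbove {μ : ℝ | pressureTT' β t t' U n = gcPressureTT' β t t' U μ - β * μ * n} := by
  set m : ℝ := (n + 2) / 2 with hm
  have hm0 : 0 ≤ m := by rw [hm]; linarith
  have hm2 : m < 2 := by rw [hm]; linarith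
  have hmn : 0 < m - n := by rw [hm]; linarith
  refine ⟨(pressureTT' β t t' U n - pressureTT' β t t' U m) / (β * (m - n)), fun μ hμ => ?_⟩
  rw [le_div_iff₀ (mul_pos hβ' hmn)]
  have k := mul_sub_le_of_mem_supportingSet hβ'.le t t' hU hμ hm0 hm2
  linarith [k]

omit hβ hU in
/-- **The supporting set of a density `0 < n < 2` is bounded below** (by the secant slope from any `m ∈ [0, n)`, `β > 0`). [cite: Rockafellar1970, Thm. 24.1] -/
theorem bddBelow_supportingSet (hβ' : 0 < β) (hU : 0 ≤ U) {n : ℝ} (hn0 : 0 < n) (hn2 : n < 2) :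
    BddBelow {μ : ℝ | pressureTT' β t t' U n = gcPressureTT' β t t' U μ - β * μ * n} := by
  set m : ℝ := n / 2 with hm
  have hm0 : 0 ≤ m := by rw [hm]; linarith
  have hm2 : m < 2 := by rw [hm]; linarith
  have hmn : 0 < n - m := by rw [hm]; linarith
  refine ⟨(pressureTT' β t t' U m - pressureTT' β t t' U n) / (β * (n - m)), fun μ hμ => ?_⟩
  rw [div_le_iff₀ (mul_pos hβ' hmn)]
  have k := mul_sub_le_of_mem_supportingSet hβ'.le t t' hU hμ hm0 hm2
  linarith [k]

omit hβ hU in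
/-- **The supporting set of a density is nonempty** (`β > 0`, `0 < n < 2`; the supporting line of the concave `p(β;·)`). [cite: Ruelle1969, §3.4] -/
theorem supportingSet_nonempty (hβ' : 0 < β) (hU : 0 ≤ U) {n : ℝ} (hn0 : 0 < n) (hn2 : n < 2) :
    {μ : ℝ | pressureTT' β t t' U n = gcPressureTT' β t t' U μ - β * μ * n}.Nonempty :=
  exists_chemicalPotential_pressureTT'_eq hβ'.le t t' hU hβ' hn0 hn2

omit hβ hU in
/-- **THE `T > 0` CHEMICAL-POTENTIAL CELL OF A DENSITY.** For `β > 0`, `U ≥ 0`, `0 < n < 2` the supporting set is the compact interval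
`M_β(n) = [sInf M_β(n), sSup M_β(n)]` (nonempty, closed, bounded, order-connected) — the `T > 0` twin of `[μ₋(n), μ₊(n)]`.
[cite: Rockafellar1970, Thm. 24.1] [cite: Ruelle1969, §3.4] -/
theorem supportingSet_eq_Icc (hβ' : 0 < β) (hU : 0 ≤ U) {n : ℝ} (hn0 : 0 < n) (hn2 : n < 2) :
    {μ : ℝ | pressureTT' β t t' U n = gcPressureTT' β t t' U μ - β * μ * n} =
      Set.Icc (sInf {μ : ℝ | pressureTT' β t t' U n = gcPressureTT' β t t' U μ - β * μ * n})
        (sSup {μ : ℝ | pressureTT' β t t' U n = gcPressureTT' β t t' U μ - β * μ * n}) := by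
  set S := {μ : ℝ | pressureTT' β t t' U n = gcPressureTT' β t t' U μ - β * μ * n} with hS
  have hne : S.Nonempty := supportingSet_nonempty t t' hβ' hU hn0 hn2
  have hconn : IsConnected S :=
    ⟨hne, (ordConnected_supportingSet hβ'.le t t' hU hn0.le hn2).isPreconnected⟩
  have hcpt : IsCompact S :=
    Metric.isCompact_of_isClosed_isBounded (isClosed_supportingSet hβ'.le t t' hU n)
      (Metric.isBounded_of_bddAbove_of_bddBelow (bddAbove_supportingSet t t' hβ' hU hn0 hn2)
        (bddBelow_supportingSet t t' hβ' hU hn0 hn2))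
  exact eq_Icc_of_connected_compact hconn hcpt

omit hβ hU in
/-- Membership form: `μ` supports `p(β;·)` at `n` iff `sInf M_β(n) ≤ μ ≤ sSup M_β(n)`. [cite: Rockafellar1970, Thm. 24.1] -/
theorem mem_supportingSet_iff_mem_Icc (hβ' : 0 < β) (hU : 0 ≤ U) {n : ℝ} (hn0 : 0 < n) (hn2 : n < 2) (μ : ℝ) :
    pressureTT' β t t' U n = gcPressureTT' β t t' U μ - β * μ * n ↔
      μ ∈ Set.Icc (sInf {μ : ℝ | pressureTT' β t t' U n = gcPressureTT' β t t' U μ - β * μ * n})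
        (sSup {μ : ℝ | pressureTT' β t t' U n = gcPressureTT' β t t' U μ - β * μ * n}) := by
  have h := supportingSet_eq_Icc t t' hβ' hU hn0 hn2
  constructor
  · intro hμ
    have : μ ∈ {μ : ℝ | pressureTT' β t t' U n = gcPressureTT' β t t' U μ - β * μ * n} := hμ
    rwa [h] at this
  · intro hμ
    have : μ ∈ {μ : ℝ | pressureTT' β t t' U n = gcPressureTT' β t t' U μ - β * μ * n} := by rw [h]; exact hμ
    exact this

end SupportingSet

end ThermodynamicLimit

namespace InfVolFermionState

section Carrier

variable (t t' : ℝ) {U : ℝ} (hU : 0 ≤ U) {β : ℝ} (hβ : 0 < β) {Γ Γ' : FermionInteraction 2} {R' R'' μ μ' : ℝ} {ω : InfVolFermionState 2}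
include hU hβ

/-- **THE CHEMICAL POTENTIALS CARRYING A GRAND-CANONICAL EQUILIBRIUM STATE FORM A COMPACT INTERVAL.** If `ω` is a grand-canonical
equilibrium state at `(β, μ)` with `0 < ρ(ω) < 2`, then for every `μ'` (shift `Γ'`): `ω` is an equilibrium state at `(β, μ')` iff
`μ' ∈ [sInf M_β(ρ(ω)), sSup M_β(ρ(ω))]`, the `T > 0` chemical-potential cell of its density (which contains `μ`).
[cite: Israel1979, Thm. I.2.4] [cite: Rockafellar1970, Thm. 24.1] -/
theorem IsVarEquilibrium.isVarEquilibrium_iff_mem_Icc (hω : ω.IsVarEquilibrium β Γ R')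
    (hΓ : ∀ σ : InfVolFermionState 2, σ.meanEnergy Γ R' = σ.meanEnergy (hubbardTTPrimeFermionInteraction t t' U) 1 - μ * σ.density)
    (hΓ' : ∀ σ : InfVolFermionState 2, σ.meanEnergy Γ' R'' = σ.meanEnergy (hubbardTTPrimeFermionInteraction t t' U) 1 - μ' * σ.density)
    (hρ0 : 0 < ω.density) (hρ2 : ω.density < 2) :
    ω.IsVarEquilibrium β Γ' R'' ↔
      μ' ∈ Set.Icc (sInf {ν : ℝ | pressureTT' β t t' U ω.density = gcPressureTT' β t t' U ν - β * ν * ω.density})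
        (sSup {ν : ℝ | pressureTT' β t t' U ω.density = gcPressureTT' β t t' U ν - β * ν * ω.density}) := by
  rw [hω.isVarEquilibrium_iff_supporting t t' hU hβ hΓ hΓ' hρ0 hρ2]
  exact ThermodynamicLimit.mem_supportingSet_iff_mem_Icc t t' hβ hU hρ0 hρ2 μ'

/-- **The carrying chemical potential lies in the cell of the density**: `μ ∈ [sInf M_β(ρ(ω)), sSup M_β(ρ(ω))]`. [cite: Ruelle1969, §3.4] -/
theorem IsVarEquilibrium.chemPot_mem_Icc_of_muShift (hω : ω.IsVarEquilibrium β Γ R')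
    (hΓ : ∀ σ : InfVolFermionState 2, σ.meanEnergy Γ R' = σ.meanEnergy (hubbardTTPrimeFermionInteraction t t' U) 1 - μ * σ.density)
    (hρ0 : 0 < ω.density) (hρ2 : ω.density < 2) :
    μ ∈ Set.Icc (sInf {ν : ℝ | pressureTT' β t t' U ω.density = gcPressureTT' β t t' U ν - β * ν * ω.density})
      (sSup {ν : ℝ | pressureTT' β t t' U ω.density = gcPressureTT' β t t' U ν - β * ν * ω.density}) :=
  (hω.isVarEquilibrium_iff_mem_Icc t t' hU hβ hΓ hΓ hρ0 hρ2).1 hω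

end Carrier

end InfVolFermionState

end Literature.MathematicalPhysics.QuantumLattice

end
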